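import Literature.AlgebraicGeometry.Hu2025.Statements.S04ModelV.R103bDescendants
import Literature.AlgebraicGeometry.Hu2025.Proofs.S04ModelV.Lem45
import HarnessLib

/-!
# Hu 2025 §4.2.2 Def. 4.11 / 4.12 — the in-text claims C22L173 «f ∈ ker^{mh} φ_[k] iff any of its descendant does»
# and C23L25 «f ∈ ker φ_[k] iff any of its partial descendant does»: KERNEL DISCHARGES AS TYPED (row 103, file
# `Proofs/S04ModelV/DescentKernel.lean`; typer of record res-type-042)

**HONEST FRAMING (D-0012/D-0089).** Theorems about OUR typed renderings in `Statements/S04ModelV/R103bDescendants.lean`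
(reading R1 = res-type-044's `IsDescentStep`/`IsPartialDescentStep`, cofactors arbitrary; reading R2 = the term-wise
`IsDescentStepR2`/`IsPartialDescentStepR2` of res-type-042). The preprint [Hu2025] (arXiv:2507.21400v1) stays «under
review»; nothing of it is asserted; AI proof is weaker than expert review; nothing here is progress on resolution of
singularities.

Proved, for every commutative ring `k`, all index data `σ, T, 𝔗, rel, mono` and every set `Φ` of relations in play:
* §1 toolkit (on top of `Lem45.lean`'s): the written / descended summands as monomials, their block weights, `R_[k]`;
* §2 one term-wise descent step preserves `R_[k]`, multi-homogeneity (block degrees `D ↦ D − e_F`) and `φ`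
  (`mem_kerMH_iff_of_isDescentStepR2`);
* §3 `C22L173_R2_holds` (reading R2 of the claim p0022 l.173 is a theorem), `C23L25_holds` (the AS-PRINTED reading of the
  claim p0023 l.25–26 is a theorem — `φ` is invariant along partial steps with arbitrary cofactors), `C23L25_ours_holds`
  (res-type-044's hypothesis-free partial step), `C23L25_R2_holds`,
  and `varphi_eq_of_isParentOf` (along R1 full steps `φ` is still invariant; what R1 does not preserve is
  multi-homogeneity — companion file `RenderingCountermodels.lean`);
* §4 `isDescentStep_of_R2`, `isParentOf_of_R2`: reading R2 refines reading R1 (every term-wise step is an R1 step).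
  (Ex. 4.14 for R2 — non-vacuity — and the R1 countermodel are in the companion `RenderingCountermodels.lean`.)

Source locators: chunks p0022 l.153–173, p0023 l.5–26 of `paper:arxiv-2507.21400`; PDF pp. 49–50
(`lit/res-lit-6/hu25/text/hu25_p049.txt` L019–L033, `hu25_p050.txt` L003–L016).
-/

noncomputable section

namespace Literature.AlgebraicGeometry.Hu2025.Statements.S04ModelV

open MvPolynomial

universe u v w x

variable {k : Type u} [CommRing k] {σ : Type v} {T : Type w} {𝔗 : Type x}

/-! ## §1 Toolkit (continued from `Lem45.lean`): the summands of an expression as monomials, `R_[k]`, block weights -/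

/-- `φ(x̄_t) = φ(x_t)`: the descended summand and the written summand have the same `φ`-image.
[cite: Hu2025, §4.2.2 Def. 4.11–4.12 + claims C22L173/C23L25, chunks p0022 l.153–173 / p0023 l.5–26, pp. 49–50 (unrefereed preprint arXiv:2507.21400v1 under adjudication, D-0012/D-0089 — kernel support on OUR typed renderings of row 103; nothing of the source asserted)] -/
theorem varphi_exprSummandBar (mono : T → (σ →₀ ℕ)) (p : T × (σ ⊕ T →₀ ℕ) × k) :
    varphi (k := k) mono (exprSummandBar (k := k) (σ := σ) mono p) =
      varphi (k := k) mono (exprSummand (k := k) (σ := σ) p) := by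
  unfold exprSummandBar exprSummand
  rw [map_mul, map_mul, varphi_toModel, varphi_rhoVar]

/-- The written summand `x_t · c x^a` is the monomial `c · x^{a + e_t}`.
[cite: Hu2025, §4.2.2 Def. 4.11–4.12 + claims C22L173/C23L25, chunks p0022 l.153–173 / p0023 l.5–26, pp. 49–50 (unrefereed preprint arXiv:2507.21400v1 under adjudication, D-0012/D-0089 — kernel support on OUR typed renderings of row 103; nothing of the source asserted)] -/
theorem exprSummand_eq (p : T × (σ ⊕ T →₀ ℕ) × k) :
    exprSummand (k := k) (σ := σ) p = monomial (Finsupp.single (Sum.inr p.1) 1 + p.2.1) p.2.2 := by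
  unfold exprSummand rhoVar
  rw [X, monomial_mul, one_mul]

/-- The descended summand `x̄_t · c x^a` is the monomial `c · x^{monoR t + a}`.
[cite: Hu2025, §4.2.2 Def. 4.11–4.12 + claims C22L173/C23L25, chunks p0022 l.153–173 / p0023 l.5–26, pp. 49–50 (unrefereed preprint arXiv:2507.21400v1 under adjudication, D-0012/D-0089 — kernel support on OUR typed renderings of row 103; nothing of the source asserted)] -/
theorem exprSummandBar_eq (mono : T → (σ →₀ ℕ)) (p : T × (σ ⊕ T →₀ ℕ) × k) :
    exprSummandBar (k := k) (σ := σ) mono p = monomial (monoR mono p.1 + p.2.1) p.2.2 := by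
  unfold exprSummandBar
  rw [toModel_img, monomial_mul, one_mul]

/-- If the written summand lies in `R_[k]`, so does the descended one (its new variables are ϖ-variables).
[cite: Hu2025, §4.2.2 Def. 4.11–4.12 + claims C22L173/C23L25, chunks p0022 l.153–173 / p0023 l.5–26, pp. 49–50 (unrefereed preprint arXiv:2507.21400v1 under adjudication, D-0012/D-0089 — kernel support on OUR typed renderings of row 103; nothing of the source asserted)] -/
theorem exprSummandBar_mem_RSub [DecidableEq σ] [DecidableEq T] (rel : T → 𝔗) (mono : T → (σ →₀ ℕ))
    (Φ : Set 𝔗) (p : T × (σ ⊕ T →₀ ℕ) × k)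
    (hp : exprSummand (k := k) (σ := σ) p ∈ RSub (k := k) rel Φ) :
    exprSummandBar (k := k) (σ := σ) mono p ∈ RSub (k := k) rel Φ := by
  by_cases hc : p.2.2 = 0
  · rw [exprSummandBar_eq, hc, map_zero]
    exact zero_mem _
  · rw [exprSummand_eq] at hp
    rw [exprSummandBar_eq]
    unfold RSub at hp ⊢
    rw [mem_supported, vars_monomial hc] at hp ⊢
    intro i hi
    rw [Finset.mem_coe, Finsupp.mem_support_iff, Finsupp.add_apply] at hi
    by_cases h1 : (monoR mono p.1) i = 0
    · rw [h1, zero_add] at hi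
      apply hp
      rw [Finset.mem_coe, Finsupp.mem_support_iff, Finsupp.add_apply]
      intro h0
      exact hi (Nat.eq_zero_of_add_eq_zero_left h0)
    · -- `i` is a ϖ-variable
      unfold monoR at h1
      by_contra hni
      exact h1 (Finsupp.mapDomain_notin_range _ _ fun hr => hni (Or.inl hr))

/-- The block-`G` weight of the written summand's exponent: `[rel t = G] + weight(a)`.
[cite: Hu2025, §4.2.2 Def. 4.11–4.12 + claims C22L173/C23L25, chunks p0022 l.153–173 / p0023 l.5–26, pp. 49–50 (unrefereed preprint arXiv:2507.21400v1 under adjudication, D-0012/D-0089 — kernel support on OUR typed renderings of row 103; nothing of the source asserted)] -/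
theorem weight_exprSummand_exp [DecidableEq 𝔗] (rel : T → 𝔗) (G : 𝔗) (t : T) (a : σ ⊕ T →₀ ℕ) :
    Finsupp.weight (blockWeight rel G) (Finsupp.single (Sum.inr t) 1 + a) =
      (if rel t = G then 1 else 0) + Finsupp.weight (blockWeight rel G) a := by
  rw [map_add, Finsupp.weight_single]
  unfold blockWeight
  simp

/-- The block-`G` weight of the descended summand's exponent: `weight(a)`.
[cite: Hu2025, §4.2.2 Def. 4.11–4.12 + claims C22L173/C23L25, chunks p0022 l.153–173 / p0023 l.5–26, pp. 49–50 (unrefereed preprint arXiv:2507.21400v1 under adjudication, D-0012/D-0089 — kernel support on OUR typed renderings of row 103; nothing of the source asserted)] -/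
theorem weight_exprSummandBar_exp [DecidableEq 𝔗] (rel : T → 𝔗) (mono : T → (σ →₀ ℕ)) (G : 𝔗) (t : T)
    (a : σ ⊕ T →₀ ℕ) :
    Finsupp.weight (blockWeight rel G) (monoR mono t + a) = Finsupp.weight (blockWeight rel G) a := by
  rw [map_add, weight_blockWeight_monoR, zero_add]

/-! ## §2 One descent step (reading R2) preserves `R_[k]`, multi-homogeneity and `φ` -/

section OneStep

variable [DecidableEq 𝔗] (rel : T → 𝔗) (mono : T → (σ →₀ ℕ)) (Φ : Set 𝔗)

/-- The value of a term-wise multi-homogeneous expression in `R_[k]` lies in `R_[k]`.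
[cite: Hu2025, §4.2.2 Def. 4.11–4.12 + claims C22L173/C23L25, chunks p0022 l.153–173 / p0023 l.5–26, pp. 49–50 (unrefereed preprint arXiv:2507.21400v1 under adjudication, D-0012/D-0089 — kernel support on OUR typed renderings of row 103; nothing of the source asserted)] -/
theorem sum_exprSummand_mem_RSub {F : 𝔗} {l : List (T × (σ ⊕ T →₀ ℕ) × k)}
    (hl : IsMHExpression (k := k) (σ := σ) rel Φ F l) :
    (l.map (exprSummand (k := k) (σ := σ))).sum ∈ RSub (k := k) rel Φ := by
  obtain ⟨D, hD⟩ := hl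
  apply Subalgebra.list_sum_mem
  intro x hx
  rw [List.mem_map] at hx
  obtain ⟨p, hp, rfl⟩ := hx
  exact (hD p hp).2.1

/-- … and so does the value of the descended expression.
[cite: Hu2025, §4.2.2 Def. 4.11–4.12 + claims C22L173/C23L25, chunks p0022 l.153–173 / p0023 l.5–26, pp. 49–50 (unrefereed preprint arXiv:2507.21400v1 under adjudication, D-0012/D-0089 — kernel support on OUR typed renderings of row 103; nothing of the source asserted)] -/
theorem sum_exprSummandBar_mem_RSub [DecidableEq σ] [DecidableEq T] {F : 𝔗}
    {l : List (T × (σ ⊕ T →₀ ℕ) × k)} (hl : IsMHExpression (k := k) (σ := σ) rel Φ F l) :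
    (l.map (exprSummandBar (k := k) (σ := σ) mono)).sum ∈ RSub (k := k) rel Φ := by
  obtain ⟨D, hD⟩ := hl
  apply Subalgebra.list_sum_mem
  intro x hx
  rw [List.mem_map] at hx
  obtain ⟨p, hp, rfl⟩ := hx
  exact exprSummandBar_mem_RSub rel mono Φ p (hD p hp).2.1

/-- The value of a term-wise multi-homogeneous expression is multi-homogeneous (block degrees `D`).
[cite: Hu2025, §4.2.2 Def. 4.11–4.12 + claims C22L173/C23L25, chunks p0022 l.153–173 / p0023 l.5–26, pp. 49–50 (unrefereed preprint arXiv:2507.21400v1 under adjudication, D-0012/D-0089 — kernel support on OUR typed renderings of row 103; nothing of the source asserted)] -/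
theorem sum_exprSummand_isWeightedHomogeneous {F : 𝔗} {l : List (T × (σ ⊕ T →₀ ℕ) × k)} {D : 𝔗 → ℕ}
    (hD : ∀ p ∈ l, rel p.1 = F ∧ exprSummand (k := k) (σ := σ) p ∈ RSub (k := k) rel Φ ∧
      ∀ G : 𝔗, IsWeightedHomogeneous (blockWeight rel G) (exprSummand (k := k) (σ := σ) p) (D G))
    (G : 𝔗) :
    IsWeightedHomogeneous (blockWeight rel G) (l.map (exprSummand (k := k) (σ := σ))).sum (D G) := by
  rw [← mem_weightedHomogeneousSubmodule]
  apply list_sum_mem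
  intro x hx
  rw [List.mem_map] at hx
  obtain ⟨p, hp, rfl⟩ := hx
  rw [mem_weightedHomogeneousSubmodule]
  exact (hD p hp).2.2 G

/-- The descended expression is multi-homogeneous, of block degrees `D − e_F`.
[cite: Hu2025, §4.2.2 Def. 4.11–4.12 + claims C22L173/C23L25, chunks p0022 l.153–173 / p0023 l.5–26, pp. 49–50 (unrefereed preprint arXiv:2507.21400v1 under adjudication, D-0012/D-0089 — kernel support on OUR typed renderings of row 103; nothing of the source asserted)] -/
theorem sum_exprSummandBar_isWeightedHomogeneous {F : 𝔗} {l : List (T × (σ ⊕ T →₀ ℕ) × k)}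
    {D : 𝔗 → ℕ}
    (hD : ∀ p ∈ l, rel p.1 = F ∧ exprSummand (k := k) (σ := σ) p ∈ RSub (k := k) rel Φ ∧
      ∀ G : 𝔗, IsWeightedHomogeneous (blockWeight rel G) (exprSummand (k := k) (σ := σ) p) (D G))
    (G : 𝔗) :
    IsWeightedHomogeneous (blockWeight rel G) (l.map (exprSummandBar (k := k) (σ := σ) mono)).sum
      (D G - (if F = G then 1 else 0)) := by
  rw [← mem_weightedHomogeneousSubmodule]
  apply list_sum_mem
  intro x hx
  rw [List.mem_map] at hx
  obtain ⟨p, hp, rfl⟩ := hx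
  rw [mem_weightedHomogeneousSubmodule]
  obtain ⟨hrel, _, hhom⟩ := hD p hp
  by_cases hc : p.2.2 = 0
  · rw [exprSummandBar_eq, hc, map_zero]
    exact isWeightedHomogeneous_zero _ _ _
  · -- the written summand has weight `D G`, hence `weight a = D G - [F = G]`
    classical
    have hw : Finsupp.weight (blockWeight rel G) (Finsupp.single (Sum.inr p.1) 1 + p.2.1) = D G := by
      have h := hhom G
      rw [exprSummand_eq] at h
      apply h
      rwa [coeff_monomial, if_pos rfl]
    rw [weight_exprSummand_exp, hrel] at hw
    rw [exprSummandBar_eq]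
    apply isWeightedHomogeneous_monomial
    rw [weight_exprSummandBar_exp, ← hw]
    simp

/-- **One term-wise descent step preserves membership in `ker^{mh} φ_Φ`** (reading R2 of Def. 4.11).
[cite: Hu2025, §4.2.2 Def. 4.11–4.12 + claims C22L173/C23L25, chunks p0022 l.153–173 / p0023 l.5–26, pp. 49–50 (unrefereed preprint arXiv:2507.21400v1 under adjudication, D-0012/D-0089 — kernel support on OUR typed renderings of row 103; nothing of the source asserted)] -/
theorem mem_kerMH_iff_of_isDescentStepR2 [DecidableEq σ] [DecidableEq T] {F : 𝔗} {f g : ModelRing σ T k}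
    (h : IsDescentStepR2 (k := k) rel mono Φ F f g) :
    f ∈ kerMH (k := k) rel mono Φ ↔ g ∈ kerMH (k := k) rel mono Φ := by
  obtain ⟨l, hl, rfl, rfl⟩ := h
  have hfR := sum_exprSummand_mem_RSub (k := k) rel Φ hl
  have hgR := sum_exprSummandBar_mem_RSub (k := k) rel mono Φ hl
  obtain ⟨D, hD⟩ := hl
  have hfH : IsMultiHomogeneous (k := k) (σ := σ) rel (l.map (exprSummand (k := k) (σ := σ))).sum :=
    fun G => ⟨D G, sum_exprSummand_isWeightedHomogeneous rel Φ hD G⟩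
  have hgH : IsMultiHomogeneous (k := k) (σ := σ) rel
      (l.map (exprSummandBar (k := k) (σ := σ) mono)).sum :=
    fun G => ⟨_, sum_exprSummandBar_isWeightedHomogeneous rel mono Φ hD G⟩
  have hφ : varphi (k := k) mono (l.map (exprSummandBar (k := k) (σ := σ) mono)).sum =
      varphi (k := k) mono (l.map (exprSummand (k := k) (σ := σ))).sum := by
    rw [map_list_sum, map_list_sum, List.map_map, List.map_map]
    congr 1
    apply List.map_congr_left
    intro p _
    exact varphi_exprSummandBar mono p
  unfold kerMH
  simp only [Set.mem_setOf_eq]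
  rw [hφ]
  exact ⟨fun h => ⟨hgR, hgH, h.2.2⟩, fun h => ⟨hfR, hfH, h.2.2⟩⟩

end OneStep

/-! ## §3 The discharges -/

/-- **Hu 2025, in-text claim chunk p0022 l.173 (end of Def. 4.11 ‹chunk 4.10›), reading R2 — DISCHARGED AS TYPED:**
`C22L173_R2 rel mono Φ` holds for every commutative ring `k`, all index data `σ, T, 𝔗, rel, mono` and every set `Φ` of
relations in play: along the term-wise parent relation, membership in `ker^{mh} φ_Φ` is invariant. (Kernel fact about
OUR rendering R2; the preprint [Hu2025] stays under review; AI proof weaker than expert review.)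
[cite: Hu2025, §4.2.2 Def. 4.11–4.12 + claims C22L173/C23L25, chunks p0022 l.153–173 / p0023 l.5–26, pp. 49–50 (unrefereed preprint arXiv:2507.21400v1 under adjudication, D-0012/D-0089 — kernel support on OUR typed renderings of row 103; nothing of the source asserted)] -/
theorem C22L173_R2_holds : ∀ {k : Type u} [CommRing k] {σ : Type v} {T : Type w} {𝔗 : Type x} [DecidableEq 𝔗] [DecidableEq σ] [DecidableEq T]
    (rel : T → 𝔗) (mono : T → (σ →₀ ℕ)) (Φ : Set 𝔗), C22L173_R2 (k := k) rel mono Φ := by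
  intro k _ σ T 𝔗 _ _ _ rel mono Φ f g h
  induction h with
  | refl => exact Iff.rfl
  | tail _ hstep ih =>
    obtain ⟨F, hF⟩ := hstep
    exact ih.trans (mem_kerMH_iff_of_isDescentStepR2 rel mono Φ hF)

/-- **Hu 2025, in-text claim chunk p0023 l.25–26 (end of Def. 4.12 ‹chunk 4.11›), AS PRINTED (`C23L25`, partial
steps from multi-homogeneous polynomials, cofactors and split arbitrary) — DISCHARGED AS TYPED:** along partial descent
steps `φ f = φ g`, so membership in `ker φ` is invariant. Holds for all parameters.
[cite: Hu2025, §4.2.2 Def. 4.11–4.12 + claims C22L173/C23L25, chunks p0022 l.153–173 / p0023 l.5–26, pp. 49–50 (unrefereed preprint arXiv:2507.21400v1 under adjudication, D-0012/D-0089 — kernel support on OUR typed renderings of row 103; nothing of the source asserted)] -/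
theorem C23L25_holds : ∀ {k : Type u} [CommRing k] {σ : Type v} {T : Type w} {𝔗 : Type x} [DecidableEq 𝔗] (rel : T → 𝔗) (mono : T → (σ →₀ ℕ)),
    C23L25 (k := k) (σ := σ) rel mono := by
  intro k _ σ T 𝔗 _ rel mono f g h
  induction h with
  | refl => exact Iff.rfl
  | tail _ hstep ih =>
    obtain ⟨F, _, l, _, rfl, rfl⟩ := hstep
    refine ih.trans ?_
    have hφ : varphi (k := k) mono
        (l.map fun p : T × ModelRing σ T k × Bool =>
          (if p.2.2 then toModel (T := T) (img (k := k) mono p.1) else rhoVar (k := k) (σ := σ) p.1) *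
            p.2.1).sum =
        varphi (k := k) mono
          (l.map fun p : T × ModelRing σ T k × Bool => (rhoVar (k := k) (σ := σ) p.1) * p.2.1).sum := by
      rw [map_list_sum, map_list_sum, List.map_map, List.map_map]
      congr 1
      apply List.map_congr_left
      intro p _
      simp only [Function.comp_apply, map_mul]
      congr 1
      split_ifs
      · rw [varphi_toModel, varphi_rhoVar]
      · rfl
    rw [hφ]

/-- **Hu 2025, in-text claim chunk p0023 l.25–26 (end of Def. 4.12 ‹chunk 4.11›), OURS reading (res-type-044's
hypothesis-free partial step, `C23L25_ours`) — DISCHARGED AS TYPED:** along partial descent steps (arbitrary cofactors, arbitrary split), `φ f = φ g`, so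
membership in `ker φ` is invariant. Holds for all parameters.
[cite: Hu2025, §4.2.2 Def. 4.11–4.12 + claims C22L173/C23L25, chunks p0022 l.153–173 / p0023 l.5–26, pp. 49–50 (unrefereed preprint arXiv:2507.21400v1 under adjudication, D-0012/D-0089 — kernel support on OUR typed renderings of row 103; nothing of the source asserted)] -/
theorem C23L25_ours_holds : ∀ {k : Type u} [CommRing k] {σ : Type v} {T : Type w} {𝔗 : Type x} (rel : T → 𝔗) (mono : T → (σ →₀ ℕ)),
    C23L25_ours (k := k) (σ := σ) rel mono := by
  intro k _ σ T 𝔗 rel mono f g h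
  induction h with
  | refl => exact Iff.rfl
  | tail _ hstep ih =>
    obtain ⟨F, l, _, rfl, rfl⟩ := hstep
    refine ih.trans ?_
    have hφ : varphi (k := k) mono
        (l.map fun p : T × ModelRing σ T k × Bool =>
          (if p.2.2 then toModel (T := T) (img (k := k) mono p.1) else rhoVar (k := k) (σ := σ) p.1) *
            p.2.1).sum =
        varphi (k := k) mono
          (l.map fun p : T × ModelRing σ T k × Bool => (rhoVar (k := k) (σ := σ) p.1) * p.2.1).sum := by
      rw [map_list_sum, map_list_sum, List.map_map, List.map_map]
      congr 1
      apply List.map_congr_left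
      intro p _
      simp only [Function.comp_apply, map_mul]
      congr 1
      split_ifs
      · rw [varphi_toModel, varphi_rhoVar]
      · rfl
    rw [hφ]

/-- **Reading R2 of the same claim (`C23L25_R2`) — DISCHARGED AS TYPED.**
[cite: Hu2025, §4.2.2 Def. 4.11–4.12 + claims C22L173/C23L25, chunks p0022 l.153–173 / p0023 l.5–26, pp. 49–50 (unrefereed preprint arXiv:2507.21400v1 under adjudication, D-0012/D-0089 — kernel support on OUR typed renderings of row 103; nothing of the source asserted)] -/
theorem C23L25_R2_holds : ∀ {k : Type u} [CommRing k] {σ : Type v} {T : Type w} {𝔗 : Type x} [DecidableEq 𝔗] (rel : T → 𝔗) (mono : T → (σ →₀ ℕ)) (Φ : Set 𝔗),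
    C23L25_R2 (k := k) rel mono Φ := by
  intro k _ σ T 𝔗 _ rel mono Φ f g h
  induction h with
  | refl => exact Iff.rfl
  | tail _ hstep ih =>
    obtain ⟨F, l, _, rfl, rfl⟩ := hstep
    refine ih.trans ?_
    have hφ : varphi (k := k) mono
        (l.map fun q : (T × (σ ⊕ T →₀ ℕ) × k) × Bool =>
          if q.2 then exprSummandBar (k := k) (σ := σ) mono q.1 else exprSummand (k := k) (σ := σ) q.1).sum =
        varphi (k := k) mono
          (l.map fun q : (T × (σ ⊕ T →₀ ℕ) × k) × Bool => exprSummand (k := k) (σ := σ) q.1).sum := by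
      rw [map_list_sum, map_list_sum, List.map_map, List.map_map]
      congr 1
      apply List.map_congr_left
      intro q _
      simp only [Function.comp_apply]
      split_ifs
      · exact varphi_exprSummandBar mono q.1
      · rfl
    rw [hφ]

/-- **The descended summand–wise claim also holds one step at a time for reading R1 AS FAR AS `φ` GOES:** along
res-type-044's `IsParentOf` (arbitrary cofactors), `φ f = φ g`. (What can fail under R1 is multi-homogeneity of the
descendant — see `not_C22L173_inst`.)
[cite: Hu2025, §4.2.2 Def. 4.11–4.12 + claims C22L173/C23L25, chunks p0022 l.153–173 / p0023 l.5–26, pp. 49–50 (unrefereed preprint arXiv:2507.21400v1 under adjudication, D-0012/D-0089 — kernel support on OUR typed renderings of row 103; nothing of the source asserted)] -/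
theorem varphi_eq_of_isParentOf [DecidableEq 𝔗] (rel : T → 𝔗) (mono : T → (σ →₀ ℕ)) {f g : ModelRing σ T k}
    (h : IsParentOf (k := k) rel mono f g) : varphi (k := k) mono f = varphi (k := k) mono g := by
  induction h with
  | refl => rfl
  | tail _ hstep ih =>
    obtain ⟨F, _, l, _, rfl, rfl⟩ := hstep
    rw [ih, map_list_sum, map_list_sum, List.map_map, List.map_map]
    congr 1
    apply List.map_congr_left
    intro p _
    simp only [Function.comp_apply, map_mul]
    rw [varphi_toModel, varphi_rhoVar]

/-! ## §4 Reading R2 refines reading R1 -/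

/-- **Every term-wise (R2) descent step is an R1 descent step** (cofactors := the terms `c_i x^{a_i}`): reading R2
refines res-type-044's reading R1; in particular `IsParentOfR2 Φ f g → IsParentOf f g` (`isParentOf_of_R2`).
[cite: Hu2025, §4.2.2 Def. 4.11–4.12 + claims C22L173/C23L25, chunks p0022 l.153–173 / p0023 l.5–26, pp. 49–50 (unrefereed preprint arXiv:2507.21400v1 under adjudication, D-0012/D-0089 — kernel support on OUR typed renderings of row 103; nothing of the source asserted)] -/
theorem isDescentStep_of_R2 [DecidableEq 𝔗] (rel : T → 𝔗) (mono : T → (σ →₀ ℕ)) (Φ : Set 𝔗) {F : 𝔗}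
    {f g : ModelRing σ T k} (h : IsDescentStepR2 (k := k) rel mono Φ F f g) :
    IsDescentStep (k := k) rel mono F f g := by
  obtain ⟨l, ⟨D, hD⟩, rfl, rfl⟩ := h
  refine ⟨fun G => ⟨D G, sum_exprSummand_isWeightedHomogeneous rel Φ hD G⟩,
    l.map fun p => (p.1, monomial p.2.1 p.2.2), ?_, ?_, ?_⟩
  · intro q hq
    rw [List.mem_map] at hq
    obtain ⟨p, hp, rfl⟩ := hq
    exact (hD p hp).1
  · rw [List.map_map]; rfl
  · rw [List.map_map]; rfl

/-- **`IsParentOfR2 Φ f g → IsParentOf f g`**: the term-wise parent relation is contained in res-type-044's.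
[cite: Hu2025, §4.2.2 Def. 4.11–4.12 + claims C22L173/C23L25, chunks p0022 l.153–173 / p0023 l.5–26, pp. 49–50 (unrefereed preprint arXiv:2507.21400v1 under adjudication, D-0012/D-0089 — kernel support on OUR typed renderings of row 103; nothing of the source asserted)] -/
theorem isParentOf_of_R2 [DecidableEq 𝔗] (rel : T → 𝔗) (mono : T → (σ →₀ ℕ)) (Φ : Set 𝔗)
    {f g : ModelRing σ T k} (h : IsParentOfR2 (k := k) rel mono Φ f g) : IsParentOf (k := k) rel mono f g := by
  induction h with
  | refl => exact Relation.ReflTransGen.refl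
  | tail _ hstep ih =>
    obtain ⟨F, hF⟩ := hstep
    exact ih.tail ⟨F, isDescentStep_of_R2 rel mono Φ hF⟩

end Literature.AlgebraicGeometry.Hu2025.Statements.S04ModelV

end
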